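import Summits.CriticalPhenomena.PercolationContinuityZ3.Theorems.Transplant.SkelPhiCellsWeakG
import Summits.CriticalPhenomena.PercolationContinuityZ3.Theorems.Transplant.PlanarCells2FaceRows2
import HarnessLib

/-!
# N1 ({±1} node), (F) part 1 (hp-8 g33): the REGION of the face step over the fine-cell scheme `cellGeomSG₂` — the plain window
# `Skelφ.Win G ψ w₀ (P.farAS₂ x du j) (rE_{a'}(x,du))` over the cell map `ψ` (a 1-Lipschitz map with WEAK steps, e.g. `fineSkel`), why it lies in the
# span `E^far_{a'}(x,du) = VWin ψ (EfarN₂ …)`, contains the target, misses the cube / stub / incoming edge region — twin of `SkelPhiConcFaceRegion` §2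
# (hp-8 g30) with `Steps ↦ WeakSteps` and `farAS ↦ farAS₂`

builds on p205010 (kernel theorem, internal audit signed; external expert review pending) — nothing in this file uses p205010; nothing here is a
claim about the open node `SamePDropOfSkeletonNeg`.
Lane `prim-bschramm`, seat `prim-hp-8` (gen 33); helper file (`--supports stmt-CriticalPhenomena-4575 --as helper`); F-COLUMN-N1-PLAN addendum (two maps:
the region lives in the CELL map; the kit levels of the face step live in the exit frame `uFrame/vFrame` and are typed in the next file).
* `Win_farAS₂_subset_Efar (hlip) (hws)` (root neighbour from a weak step, 1-thickening `farAS₂ → EfarN₂`), `M_subset_Win_farAS₂` (`j ≤ K`, `WF2.ME`),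
  `Face_subset_Win_faceRow₂` (the face as a cell-map window), `sep_Q_Win_farAS₂ (hlip)`, `disjoint_Win_farAS₂_Stub`, `disjoint_Win_farAS₂_Ewv`, `Win_farAS₂_subset_Win_farAS`.
[cite: KozmaNitzan2024, §4 p. 26 (E_{v,x}, M_x), p. 27 ((30)), p. 30 (Step III: F^{j+1} and the levels above it), p. 31 (D is a subbox of Ω)]
-/

noncomputable section

open scoped Classical

namespace Summit.CriticalPhenomena.PercolationContinuityZ3.Theorems.Transplant

namespace Skelφ

open Literature.Probability.Percolation Literature.Probability.LatticeModels SimpleGraph KNCells Contour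
open Literature.Probability.Percolation.KozmaNitzan
open Literature.Probability.Percolation.KozmaNitzan.Cells (oth oth_ne sgOf sgOf_sign stepVec_apply_fst stepVec_apply_oth eq_oth_of_ne oth_oth)
open Literature.Barriers.CriticalPhenomena (graphBall graphBall_finite mem_graphBall_self graphBall_mono)
open BoxProdZ2 (ConcRadiiG)

variable {V : Type} [DecidableEq V] {G : SimpleGraph V} [G.LocallyFinite] {ψ : V → Site 2}

variable (P : PCells2) (w₀ : V) {Λ : ConcRadiiG}

/-- **The face-step window lies in the far region of the fine-cell scheme**: `Win w₀ (farAS₂ x du j) (rE_{a'}(x,du)) ⊆ E^far_{a'}(x, du) = VWin (EfarN₂ …)`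
as soon as `1 ≤ rE_{a'}(x, du)`; the root's neighbour comes from a weak step (no `Steps` of the cell map). [cite: KozmaNitzan2024, §4 p. 31 (D ⊆ Ω)] -/
theorem Win_farAS₂_subset_Efar (hlip : Lip G ψ) (hws : WeakSteps G ψ) {a' : ℕ} {x : Site 2} {du : MDir} (hE : 1 ≤ Λ.rE a' x du) (j : ℕ) :
    Win G ψ w₀ (P.farAS₂ x du j) (Λ.rE a' x du) ⊆ (cellGeomSG₂ G ψ P w₀ Λ).Efar a' x du := by
  obtain ⟨y₀, hy₀, -⟩ := hws w₀ 0 1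
  exact Win_subset_VWin_of_thicken_of_adj hlip hy₀ (fun _ ht _ h => P.mem_EfarN₂_of_near_farAS₂ ht h) hE

/-- **The true target lies in the face-step window**: `M_{a'}(x + du) ⊆ Win w₀ (farAS₂ x du j) (rE_{a'}(x,du))` (`j ≤ K`, `rM ≤ rE`).
[cite: KozmaNitzan2024, §4 p. 26 (M_x ⊆ E_{v,x})] -/
theorem M_subset_Win_farAS₂ (hW : WF2 P Λ) {a' : ℕ} (x : Site 2) (du : MDir) {j : ℕ} (hj : j ≤ P.K) :
    (cellGeomSG₂ G ψ P w₀ Λ).M a' (x + stepVec du) ⊆ Win G ψ w₀ (P.farAS₂ x du j) (Λ.rE a' x du) := by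
  change VWin G ψ w₀ (P.M (x + stepVec du)) (Λ.rM a' (x + stepVec du)) ⊆ _
  exact (VWin_subset_Win w₀ _ _).trans (Win_mono G ψ (P.M_add_stepVec_subset_farAS₂ x du hj) (hW.ME a' x du))

/-- **The face `F^{j+1}` lies in the zeroth cell-map window over the shifted face row**: `Face_{a'}(x, du, j+1) ⊆ Win w₀ [faceLo, faceHi] rE`
(the source text of `SkelPhiConcFaceRegion`, scheme-independent). [cite: KozmaNitzan2024, §4 p. 30 (Step III: the source box F^{j+1})] -/
theorem Face_subset_Win_faceRow₂ (hW : WF2 P Λ) (a' : ℕ) (x : Site 2) (du : MDir) (j : ℕ) :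
    (faceDataSG G ψ P w₀ Λ).Face a' x du (j + 1) ⊆ Win G ψ w₀ (Finset.Icc (P.faceLo x du j) (P.faceHi x du j)) (Λ.rE a' x du) := by
  intro y hy
  change y ∈ (VStair G ψ w₀ (P.Stub x du (j + 1)) (prof P Λ a' x du)).filter
    (fun y => P.lev du x (ψ y) = 5 * (P.r du.1 : ℤ) + 10 * (P.s du.1 : ℤ) * (j + 1 : ℕ) - 1) at hy
  obtain ⟨hy, hl⟩ := Finset.mem_filter.1 hy
  obtain ⟨hP, hd⟩ := mem_of_mem_VStair hy
  exact (mem_Win G ψ).2 ⟨graphBall_mono G w₀ (hW.ρE a' x du _) hd, P.mem_faceRow_of_mem_Stub hP hl⟩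

/-- The face lies in the face-step window (`j + 1 ≤ K`). [folklore] -/
theorem Face_subset_Win_farAS₂ (hW : WF2 P Λ) (a' : ℕ) (x : Site 2) (du : MDir) {j : ℕ} (hj : j + 1 ≤ P.K) :
    (faceDataSG G ψ P w₀ Λ).Face a' x du (j + 1) ⊆ Win G ψ w₀ (P.farAS₂ x du j) (Λ.rE a' x du) :=
  (Face_subset_Win_faceRow₂ P w₀ hW a' x du j).trans (Win_mono G ψ (P.faceRow_subset_farAS₂ x du hj) le_rfl)

omit [DecidableEq V] in
/-- **No `G`-edge from the cube span `Q_a(x)` into the face-step window** (from `Lip`). [cite: KozmaNitzan2024, §4 p. 26 ((29))] -/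
theorem sep_Q_Win_farAS₂ [DecidableEq V] (hlip : Lip G ψ) (a : ℕ) (x : Site 2) (du : MDir) (j R : ℕ) :
    KNCells.Sep G ((cellGeomSG₂ G ψ P w₀ Λ).Q a x) (Win G ψ w₀ (P.farAS₂ x du j) R) :=
  sep_of_sepInf hlip (P.Q_sepInf_farAS₂ x du j) (fun _ ha => φ_mem_of_mem_VWin ha) (fun _ hb => ((mem_Win G ψ).1 hb).2)

/-- The face-step window misses the stub span `Stub_{a'}(x, du, j)`. [folklore] -/
theorem disjoint_Win_farAS₂_Stub (a' : ℕ) (x : Site 2) (du : MDir) (j R : ℕ) :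
    Disjoint (Win G ψ w₀ (P.farAS₂ x du j) R) ((cellGeomSG₂ G ψ P w₀ Λ).Stub a' x du j) := by
  change Disjoint _ (VStair G ψ w₀ (P.Stub x du j) (prof P Λ a' x du))
  exact Finset.disjoint_left.2 fun y ha hb => Finset.disjoint_left.1 (P.farAN₂_disjoint_Stub x du j)
    (P.farAS₂_subset_farAN₂ x du j ((mem_Win G ψ).1 ha).2) (mem_of_mem_VStair hb).1

/-- The face-step window misses `E_{w,v}` of the incoming edge (`du ≠ rev δw`). [folklore] -/
theorem disjoint_Win_farAS₂_Ewv (a : ℕ) (w : Site 2) {δw du : MDir} (hne : du ≠ rev δw) (j R : ℕ) :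
    Disjoint (Win G ψ w₀ (P.farAS₂ (w + stepVec δw) du j) R) ((cellGeomSG₂ G ψ P w₀ Λ).Ewv a w δw) := by
  have h := P.EwvN_disjoint_EfarN w hne
  rw [PCells2.EwvN, Finset.disjoint_union_left] at h
  have hsub : P.farAS₂ (w + stepVec δw) du j ⊆ P.EfarN (w + stepVec δw) du :=
    (P.farAS₂_subset_EfarN₂ _ du j).trans (P.EfarN₂_subset_EfarN _ du)
  change Disjoint _ (VWin G ψ w₀ (P.BtwN w δw) (Λ.rB a w δw) ∪ VWin G ψ w₀ (P.Q (w + stepVec δw)) (Λ.rQ a (w + stepVec δw)))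
  rw [Finset.disjoint_union_right]
  refine ⟨Finset.disjoint_left.2 fun y ha hb => Finset.disjoint_left.1 h.1.symm (hsub ((mem_Win G ψ).1 ha).2) (φ_mem_of_mem_VWin hb),
    Finset.disjoint_left.2 fun y ha hb => Finset.disjoint_left.1 h.2.symm (hsub ((mem_Win G ψ).1 ha).2) (φ_mem_of_mem_VWin hb)⟩

omit [DecidableEq V] in
/-- The face-step window of N1 lies in the D″-shaped window over `farAS` (so every `hlip`-only lemma about `Win (farAS …)` applies to it). [folklore] -/
theorem Win_farAS₂_subset_Win_farAS (x : Site 2) (du : MDir) (j R : ℕ) : Win G ψ w₀ (P.farAS₂ x du j) R ⊆ Win G ψ w₀ (P.farAS x du j) R :=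
  Win_mono G ψ (P.farAS₂_subset_farAS x du j) le_rfl

end Skelφ

end Summit.CriticalPhenomena.PercolationContinuityZ3.Theorems.Transplant

end
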